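import Summits.QuantumAdvantage.QuantumAdvantage.Theorems.CharDialLevelDialB

/-!
# CharDialLevelDialC — part C of the decomp-qadv lens-5 g29 node «LevelDial» on `CharDial.FrobStructureLawOdd` (stmt-QuantumAdvantage-27205):
# PAIRED BUDGETS — a pure insertion after parts A/B (tree), answering the critic's remark (CRITIC-LEDGER 74v28) that `closes` consumes the
# glue only at the budget of the finite range.

`GlueAt p` is typed for every budget `K`, but `closes` consumes the glue only at the budget of the finite range.  This file records the
lighter, still exact, pairing: `GlueK p K` = the glue at ONE budget, `PairAt p := ∃ K, RPrimeAt p K (nB p K) ∧ GlueK p K`, and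
`exchCoreAt_iff_pairAt : ExchCoreAt p ↔ PairAt p`; over the odd primes `PairOdd`, `closes_pair : PairOdd → IslandOdd → FrobStructureLawOdd` and
`target_iff_pair : FrobStructureLawOdd ↔ PairOdd ∧ IslandOdd`.  At `p = 5` the pair is (census-certified `RPrimeAt 5 1 8`, PLAN-g9 §11.4's glue at
`K = 1`).  No statement of parts A/B is touched; 3 defs + 9 theorems, all sorry-free.
-/

set_option autoImplicit false
set_option linter.dupNamespace false

namespace Summit.QuantumAdvantage.QuantumAdvantage.Theorems.LevelDial

open Finset
open Summit.QuantumAdvantage.AdviceFreeQNC0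
open Literature.Computability.MetaComplexity Literature.Computability.MetaComplexity.Smolensky
open Summit.QuantumAdvantage.QuantumAdvantage.Theorems.IslandDial (Exch TopConst ExchCoreAt ExchCoreOdd IslandAt IslandOdd)

/-- GLUE at ONE budget `K` (the body of `GlueAt p` at `K`). -/
def GlueK (p : ℕ) [Fact p.Prime] (K : ℕ) : Prop :=
  ∃ E : ℕ, ∀ (n : ℕ) (f : (Fin n → Bool) → Bool) (X : Finset (Fin n)), HasDegF p f (p - 1) →
    (∃ γ : ZMod p, γ ≠ 0 ∧ TopConst p f X γ) →
    (∀ σ : Fin n → Bool, ∃ Y : Finset (Fin n), Y ⊆ X ∧ X.card ≤ Y.card + K ∧ Exch (fun u => f (SubLog.merge X u σ)) Y) →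
    ∃ Y : Finset (Fin n), Y ⊆ X ∧ X.card ≤ Y.card + E ∧ Exch f Y

/-- `GlueAt p` is the glue at every budget (definitional). -/
theorem glueAt_iff_forall_glueK (p : ℕ) [Fact p.Prime] : GlueAt p ↔ ∀ K : ℕ, GlueK p K := Iff.rfl

/-- PAIRED BUDGETS at `p`: finite range and glue at the SAME budget `K`. -/
def PairAt (p : ℕ) [Fact p.Prime] : Prop := ∃ K : ℕ, RPrimeAt p K (nB p K) ∧ GlueK p K

/-- Paired budgets over the odd primes `p ≥ 5`. -/
def PairOdd : Prop := ∀ (p : ℕ) [Fact p.Prime], 5 ≤ p → PairAt p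

/-- Asymptotic regime at budget `K` + glue at budget `K` ⟹ piece E at `p` (the proof of `exchCoreAt_of_tail_glue`, one budget). -/
theorem exchCoreAt_of_tailK_glueK (p : ℕ) [Fact p.Prime] {K : ℕ} (hK : ∀ m : ℕ, nB p K ≤ m → RPrimeAt p K m)
    (hG : GlueK p K) : ExchCoreAt p := by
  classical
  obtain ⟨E, hE⟩ := hG
  refine ⟨E + nB p K, fun n f X hf hγ => ?_⟩
  by_cases hX : nB p K ≤ X.card
  · obtain ⟨γ, hγ0, htop⟩ := hγ
    obtain ⟨Y, hYX, hc, hex⟩ := hE n f X hf ⟨γ, hγ0, htop⟩ fun σ =>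
      hK X.card hX n _ X rfl (depOn_slice f X σ) (hasDegF_slice hf X σ)
        ⟨γ, hγ0, topConst_slice hf htop (subset_refl _) (subset_refl _) σ⟩
    exact ⟨Y, hYX, by omega, hex⟩
  · refine ⟨∅, Finset.empty_subset _, ?_, fun i hi => absurd hi (by simp)⟩
    rw [Finset.card_empty]
    omega

/-- Paired budgets ⟹ piece E at `p` (bridge `tail_of_base` + one-budget glue). -/
theorem exchCoreAt_of_pairAt (p : ℕ) [Fact p.Prime] (h : PairAt p) : ExchCoreAt p := by
  obtain ⟨K, hB, hG⟩ := h
  exact exchCoreAt_of_tailK_glueK p (tail_of_base hB) hG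

/-- Necessity of the pairing: piece E gives the finite range and the glue at its own budget. -/
theorem pairAt_of_exchCoreAt (p : ℕ) [Fact p.Prime] (hE : ExchCoreAt p) : PairAt p := by
  obtain ⟨K, hK⟩ := rPrimeAt_of_exchCoreAt p hE
  exact ⟨K, hK _, glueAt_of_exchCoreAt p hE K⟩

/-- ★ Piece E at `p` ⟺ paired budgets. -/
theorem exchCoreAt_iff_pairAt (p : ℕ) [Fact p.Prime] : ExchCoreAt p ↔ PairAt p :=
  ⟨pairAt_of_exchCoreAt p, exchCoreAt_of_pairAt p⟩

/-- `BaseAt ∧ GlueAt` ⟹ paired budgets (the pairing is lighter than the g29 pieces). -/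
theorem pairAt_of_baseAt_glueAt (p : ℕ) [Fact p.Prime] (hB : BaseAt p) (hG : GlueAt p) : PairAt p := by
  obtain ⟨K, hK⟩ := hB
  exact ⟨K, hK, hG K⟩

/-- `closes_pair`: paired budgets and the island piece decide the target BY NAME. -/
theorem closes_pair (hP : PairOdd) (hI : IslandOdd) :
    Summit.QuantumAdvantage.QuantumAdvantage.Theses.CharDial.FrobStructureLawOdd :=
  Summit.QuantumAdvantage.QuantumAdvantage.Theorems.IslandDial.closes (fun p _ hp5 => exchCoreAt_of_pairAt p (hP p hp5)) hI

/-- Necessity of the paired budgets. -/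
theorem pairOdd_of_target (hT : Summit.QuantumAdvantage.QuantumAdvantage.Theses.CharDial.FrobStructureLawOdd) : PairOdd :=
  fun p _ hp5 => pairAt_of_exchCoreAt p
    (Summit.QuantumAdvantage.QuantumAdvantage.Theorems.IslandDial.exchCoreOdd_of_target hT p hp5)

/-- ★ EXACT: target ⟺ paired budgets ∧ island piece. -/
theorem target_iff_pair :
    Summit.QuantumAdvantage.QuantumAdvantage.Theses.CharDial.FrobStructureLawOdd ↔ (PairOdd ∧ IslandOdd) :=
  ⟨fun hT => ⟨pairOdd_of_target hT, Summit.QuantumAdvantage.QuantumAdvantage.Theorems.IslandDial.islandOdd_of_target hT⟩,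
    fun h => closes_pair h.1 h.2⟩

end Summit.QuantumAdvantage.QuantumAdvantage.Theorems.LevelDial
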